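import Summits.QuantumFields.YangMills.Theorems.AllWindowsColdBoxBoxHighLineTiltSupBounds
import Summits.QuantumFields.YangMills.Theorems.AllWindowsColdBoxBoxHighLineSmearedFPOperatorPerturbation
import Summits.QuantumFields.YangMills.Theorems.AllWindowsColdBoxBoxHighLineSmearedFPOperatorFloor
import Summits.QuantumFields.YangMills.Theorems.AllWindowsColdBoxBoxHighLineSmallFieldInsideFP
import Summits.QuantumFields.YangMills.Theorems.AllWindowsColdBoxBoxHighLineActionSandwich
import Summits.QuantumFields.YangMills.Theorems.AllWindowsColdBoxBoxHighLineErrorBudget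

/-!
# T-S5.6b from T-S5.7d — the two-configuration Faddeev–Popov DETERMINANT RATIO on the small-field box, and T-S5.6 `SmallFieldInsideFP` GIVEN 7d
# (planner ym-idea-2 g18 19:54:19Z «h6b is a COROLLARY of T-S5.7d GhostTaylor … |ghostLogRatio a − ghostLogRatio a′| ≤ |quadVal M_H a| + |quadVal M_H a′|
# + 2C H⁶ log^m t³ ≤ C₇·t·H⁵ whenever t·H² ≤ c₇»; ASSEMBLY-S5 §4 Step C; LINE-19 S5 ⟨stmt-QuantumFields-24004⟩/⟨24335⟩, LINE-20 U5 ⟨24336⟩)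

Width seat `ym-line-sfw-p2-w4` (prover-ym-line-sfw-p2-w4-g28-0).  Everything here takes T-S5.7d `GhostTaylor` as a HYPOTHESIS (verbatim, w3 g40's brick;
nothing of it is restated) — the moment `ghostTaylor : GhostTaylor` lands, T-S5.6 is closed by `smallFieldInsideFP_of_ghostTaylor ghostTaylor`.

* `TiltSup.linkDefect_edgeChart_le_sq` / **`det_fpOperator_edgeChart_ne_zero`** — on `smallField H t` with `t·H² ≤ 1/2016` (`H ≥ 1`) the FP operator of the chart
  configuration is invertible (✓4c-E `fpOperator_sub_one_opBound_of_linkDefect`, `m = 252t < (1/4)/H²`, ✓4f `SpectralFloor.fpOperator_inv_of_sub_one`);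
* `TiltSup.one_add_log_pow_le_mul` — `(1 + log H)^m ≤ (1+m)^m·H` for `H ≥ 1` (w2's ✓`ErrorBudget.one_add_log_pow_le` at `δ = 1/m`);
* `TiltSup.abs_ghostLogRatio_sub_le_of` — GIVEN 7d: `|ghostLogRatio H a − ghostLogRatio H a′| ≤ C₇·t·H⁵` for `a, a′ ∈ smallField H t`, `t·H² ≤ c₇`
  (`|quadVal M a| ≤ √(ΣM²)·216H⁴t²` ✓`TiltSup.abs_quadVal_le`, the two cubic tails, `(1+log H)^m ≤ (1+m)^m H`, `t·H² ≤ c₇ ≤ 1`);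
* **`TiltSup.detRatio_of_ghostTaylor`** — GIVEN 7d, EXACTLY the hypothesis `h6b` of ✓`SmallFieldFP.smallFieldInsideFP_of` (p741467):
  `∃ C₇ c₇, 0 < c₇ ∧ ∀ H ≥ 1, ∀ t ≥ 0, t·H² ≤ c₇ → ∀ a a′ ∈ smallField H t, |det F(U(a))| ≤ exp(C₇·t·H⁵)·|det F(U(a′))|`;
* **`smallFieldInsideFP_of_ghostTaylor : GhostTaylor → SmallFieldInsideFP`** — T-S5.6 modulo 7d only (6a = ✓`actionSandwich`, w2 g31 p741826).

Everything proved; no definitions; standard axioms.  HONEST LABEL: conditional closure of the task T-S5.6 of STEP 2 of the XL stub S5 of a critic-PASSed DRAFT line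
(the hypothesis 7d `GhostTaylor` is OPEN, w3 g40); S5, U5, ⟨24004⟩ ⟨24335⟩ ⟨24336⟩ remain OPEN; no crux, rung or summit is proved; the Yang–Mills mass gap is
NOT proved by this file.
-/

set_option autoImplicit false

open MeasureTheory Real Finset Matrix
open Literature.Probability.LatticeModels (Site)
open Literature.MathematicalPhysics.QuantumFieldTheory.AxialGauge (boxEdges)
open Literature.MathematicalPhysics.QuantumLattice (ZdEdge)

namespace Summit.QuantumFields.YangMills.Theorems.AllWindowsColdBoxBoxHighLine

namespace TiltSup

variable {H : ℕ}

/-! ## The FP determinant does not vanish on the small-field box -/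

/-- On `smallField H t` (`t ≤ π`) every cold-box link of `U(a)` has defect `≤ t²` (✓`FPChart.linkDefect_edgeChart_le`). -/
theorem linkDefect_edgeChart_le_sq {t : ℝ} (htπ : t ≤ Real.pi) {a : LandauFree H → E3} (ha : a ∈ smallField H t)
    (E : ZdEdge 4) (hE : E ∈ boxEdges 4 (2 * H + 1)) : linkDefect (edgeChart H a) E ≤ t ^ 2 := by
  let e : LandauFree H := ⟨⟨E, mem_boxEdgesAt_of_mem_boxEdges hE⟩, not_not_intro hE⟩
  have h := FPChart.linkDefect_edgeChart_le a e ((ha e).trans htπ)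
  calc linkDefect (edgeChart H a) E = linkDefect (edgeChart H a) e.1.1 := rfl
    _ ≤ ‖a e‖ ^ 2 := h
    _ ≤ t ^ 2 := pow_le_pow_left₀ (norm_nonneg _) (ha e) 2

/-- **`det F_FP(U(a)) ≠ 0` on `smallField H t` whenever `t·H² ≤ 1/2016`, `H ≥ 1`** (`‖F(U) − F(1)‖ ≤ 252t < λ_min(F(1)) = (1/4)/H²`:
✓`fpOperator_sub_one_opBound_of_linkDefect` + ✓`SpectralFloor.fpOperator_inv_of_sub_one`). -/
theorem det_fpOperator_edgeChart_ne_zero (hH : 1 ≤ H) {t : ℝ} (ht0 : 0 ≤ t) (htH : t * (H : ℝ) ^ 2 ≤ 1 / 2016)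
    {a : LandauFree H → E3} (ha : a ∈ smallField H t) : (fpOperator H (edgeChart H a)).det ≠ 0 := by
  have hH1 : (1 : ℝ) ≤ H := by exact_mod_cast hH
  have hH2 : (1 : ℝ) ≤ (H : ℝ) ^ 2 := one_le_pow₀ hH1
  have ht1 : t ≤ 1 := by nlinarith
  have htπ : t ≤ Real.pi := ht1.trans (by linarith [Real.pi_gt_three])
  have hU : ∀ E ∈ boxEdges 4 (2 * H + 1), linkDefect (edgeChart H a) E ≤ t ^ 2 :=
    fun E hE => linkDefect_edgeChart_le_sq htπ ha E hE
  have hE := fpOperator_sub_one_opBound_of_linkDefect (edgeChart H a) ht0 ht1 hU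
  have hm : (0 : ℝ) ≤ 252 * t := by positivity
  have hmH : 252 * t < 1 / 4 / (H : ℝ) ^ 2 := by
    rw [lt_div_iff₀ (by positivity)]
    nlinarith
  exact (SpectralFloor.fpOperator_inv_of_sub_one hH (edgeChart H a) hm hmH hE).1.ne_zero

/-! ## The logarithmic factor -/

/-- `(1 + log H)^m ≤ (1 + m)^m · H` for `H ≥ 1` (✓`ErrorBudget.one_add_log_pow_le` with `δ = 1/m`; `m = 0` trivially). -/
theorem one_add_log_pow_le_mul {x : ℝ} (hx : 1 ≤ x) (m : ℕ) : (1 + Real.log x) ^ m ≤ (1 + (m : ℝ)) ^ m * x := by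
  rcases Nat.eq_zero_or_pos m with hm | hm
  · subst hm; simpa using hx
  have hmpos : (0 : ℝ) < m := by exact_mod_cast hm
  have h := ErrorBudget.one_add_log_pow_le (δ := 1 / (m : ℝ)) (by positivity) hx m
  have h1 : (m : ℝ) * (1 / (m : ℝ)) = 1 := by field_simp
  rw [h1, Real.rpow_one, one_div_one_div] at h
  exact h

/-! ## 6b: the two-configuration determinant ratio, GIVEN 7d -/

/-- **GIVEN T-S5.7d**: `|ghostLogRatio H a − ghostLogRatio H a′| ≤ C₇·t·H⁵` for `a, a′ ∈ smallField H t`, `0 ≤ t`, `t·H² ≤ c₇`, `H ≥ 1`,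
with `c₇ = min c₀ 1` and `C₇ = 2·(1+m)^m·(max(C,0) + 216·√max(C,0))` from 7d's constants. -/
theorem abs_ghostLogRatio_sub_le_of (h7d : GhostTaylor) :
    ∃ C₇ c₇ : ℝ, 0 < c₇ ∧ c₇ ≤ 1 ∧ ∀ H : ℕ, 1 ≤ H → ∀ t : ℝ, 0 ≤ t → t * (H : ℝ) ^ 2 ≤ c₇ →
      ∀ a a' : LandauFree H → E3, a ∈ smallField H t → a' ∈ smallField H t →
        |ghostLogRatio H a - ghostLogRatio H a'| ≤ C₇ * t * (H : ℝ) ^ 5 := by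
  obtain ⟨C, c₀, m, hc₀, hG⟩ := h7d
  set K : ℝ := max C 0 + 216 * Real.sqrt (max C 0) with hK
  have hK0 : 0 ≤ K := by positivity
  refine ⟨2 * (1 + (m : ℝ)) ^ m * K, min c₀ 1, lt_min hc₀ one_pos, min_le_right _ _, fun H hH t ht0 htH a a' ha ha' => ?_⟩
  obtain ⟨M, hM, hT⟩ := hG H hH
  have hH1 : (1 : ℝ) ≤ H := by exact_mod_cast hH
  have hH2 : (1 : ℝ) ≤ (H : ℝ) ^ 2 := one_le_pow₀ hH1
  have htc₀ : t * (H : ℝ) ^ 2 ≤ c₀ := htH.trans (min_le_left _ _)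
  have ht1' : t * (H : ℝ) ^ 2 ≤ 1 := htH.trans (min_le_right _ _)
  have ht1 : t ≤ 1 := by nlinarith
  have hL : 1 ≤ 1 + Real.log H := by have := Real.log_nonneg hH1; linarith
  have hLm : 1 ≤ (1 + Real.log (H : ℝ)) ^ m := one_le_pow₀ hL
  -- the pointwise bound `|ghostLogRatio b| ≤ K·H⁶·L^m·t²` for `b ∈ smallField H t` (quadratic part + cubic tail, `t ≤ 1`)
  have hX0 : 0 ≤ (H : ℝ) ^ 4 * (1 + Real.log H) ^ m := by positivity
  have hM' : ∑ i, ∑ j, M i j ^ 2 ≤ max C 0 * (H : ℝ) ^ 4 * (1 + Real.log H) ^ m := by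
    refine hM.trans ?_
    rw [mul_assoc, mul_assoc]
    exact mul_le_mul_of_nonneg_right (le_max_left _ _) hX0
  have hsq : Real.sqrt (∑ i, ∑ j, M i j ^ 2) ≤ Real.sqrt (max C 0) * (H : ℝ) ^ 2 * (1 + Real.log H) ^ m :=
    (Real.sqrt_le_sqrt hM').trans (sqrt_bound_le (le_max_right _ _) hL (H : ℝ) m)
  have hcard := SmallFieldFP.card_landauFree_le (H := H) hH
  have hpt : ∀ b : LandauFree H → E3, b ∈ smallField H t →
      |ghostLogRatio H b| ≤ K * (H : ℝ) ^ 6 * (1 + Real.log H) ^ m * t ^ 2 := by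
    intro b hb
    have hrem : |ghostLogRatio H b - quadVal M b| ≤ C * (H : ℝ) ^ 6 * (1 + Real.log H) ^ m * t ^ 3 := hT t b ht0 htc₀ hb
    have hrem' : |ghostLogRatio H b - quadVal M b| ≤ max C 0 * (H : ℝ) ^ 6 * (1 + Real.log H) ^ m * t ^ 2 := by
      refine hrem.trans ?_
      have ht32 : t ^ 3 ≤ t ^ 2 := pow_le_pow_of_le_one ht0 ht1 (by norm_num)
      calc C * (H : ℝ) ^ 6 * (1 + Real.log H) ^ m * t ^ 3 ≤ max C 0 * (H : ℝ) ^ 6 * (1 + Real.log H) ^ m * t ^ 3 := by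
            have h0' : 0 ≤ (H : ℝ) ^ 6 * (1 + Real.log H) ^ m * t ^ 3 := by positivity
            calc C * (H : ℝ) ^ 6 * (1 + Real.log H) ^ m * t ^ 3 = C * ((H : ℝ) ^ 6 * (1 + Real.log H) ^ m * t ^ 3) := by ring
              _ ≤ max C 0 * ((H : ℝ) ^ 6 * (1 + Real.log H) ^ m * t ^ 3) := mul_le_mul_of_nonneg_right (le_max_left _ _) h0'
              _ = _ := by ring
        _ ≤ max C 0 * (H : ℝ) ^ 6 * (1 + Real.log H) ^ m * t ^ 2 := by gcongr
    have hsumH : ∑ e, ‖b e‖ ^ 2 ≤ 216 * (H : ℝ) ^ 4 * t ^ 2 :=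
      (sum_norm_sq_le hb).trans (mul_le_mul_of_nonneg_right hcard (sq_nonneg _))
    have hq : |quadVal M b| ≤ Real.sqrt (max C 0) * (H : ℝ) ^ 2 * (1 + Real.log H) ^ m * (216 * (H : ℝ) ^ 4 * t ^ 2) :=
      (abs_quadVal_le M b).trans (mul_le_mul hsq hsumH (Finset.sum_nonneg fun e _ => sq_nonneg _) (by positivity))
    have hsplit : |ghostLogRatio H b| ≤ |ghostLogRatio H b - quadVal M b| + |quadVal M b| := by
      have := abs_add_le (ghostLogRatio H b - quadVal M b) (quadVal M b)
      rwa [sub_add_cancel] at this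
    refine hsplit.trans ((add_le_add hrem' hq).trans (le_of_eq ?_))
    rw [hK]; ring
  -- `(1+log H)^m ≤ (1+m)^m·H` and `t·H² ≤ c₇ ≤ 1`
  have hlog := one_add_log_pow_le_mul hH1 m
  have hdiff : |ghostLogRatio H a - ghostLogRatio H a'| ≤ 2 * (K * (H : ℝ) ^ 6 * (1 + Real.log H) ^ m * t ^ 2) := by
    have := abs_sub (ghostLogRatio H a) (ghostLogRatio H a')
    linarith [hpt a ha, hpt a' ha']
  refine hdiff.trans ?_
  have h6 : (H : ℝ) ^ 6 * (1 + Real.log H) ^ m * t ^ 2 ≤ (1 + (m : ℝ)) ^ m * (t * (H : ℝ) ^ 5) := by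
    have h7 : (H : ℝ) ^ 6 * (1 + Real.log H) ^ m ≤ (1 + (m : ℝ)) ^ m * (H : ℝ) ^ 7 := by
      calc (H : ℝ) ^ 6 * (1 + Real.log H) ^ m ≤ (H : ℝ) ^ 6 * ((1 + (m : ℝ)) ^ m * H) :=
            mul_le_mul_of_nonneg_left hlog (by positivity)
        _ = (1 + (m : ℝ)) ^ m * (H : ℝ) ^ 7 := by ring
    have ht2 : (H : ℝ) ^ 7 * t ^ 2 ≤ t * (H : ℝ) ^ 5 := by
      have : (H : ℝ) ^ 7 * t ^ 2 = (t * (H : ℝ) ^ 5) * (t * (H : ℝ) ^ 2) := by ring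
      rw [this]
      exact mul_le_of_le_one_right (by positivity) ht1'
    calc (H : ℝ) ^ 6 * (1 + Real.log H) ^ m * t ^ 2 ≤ (1 + (m : ℝ)) ^ m * (H : ℝ) ^ 7 * t ^ 2 :=
          mul_le_mul_of_nonneg_right h7 (sq_nonneg _)
      _ = (1 + (m : ℝ)) ^ m * ((H : ℝ) ^ 7 * t ^ 2) := by ring
      _ ≤ (1 + (m : ℝ)) ^ m * (t * (H : ℝ) ^ 5) := mul_le_mul_of_nonneg_left ht2 (by positivity)
  calc 2 * (K * (H : ℝ) ^ 6 * (1 + Real.log H) ^ m * t ^ 2) = 2 * K * ((H : ℝ) ^ 6 * (1 + Real.log H) ^ m * t ^ 2) := by ring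
    _ ≤ 2 * K * ((1 + (m : ℝ)) ^ m * (t * (H : ℝ) ^ 5)) := mul_le_mul_of_nonneg_left h6 (by positivity)
    _ = 2 * (1 + (m : ℝ)) ^ m * K * t * (H : ℝ) ^ 5 := by ring

/-- **6b GIVEN T-S5.7d — the hypothesis `h6b` of ✓`SmallFieldFP.smallFieldInsideFP_of`, verbatim**: for `a, a′ ∈ smallField H t`, `0 ≤ t`, `t·H² ≤ c₇`, `H ≥ 1`:
`|det F(U(a))| ≤ exp(C₇·t·H⁵)·|det F(U(a′))|` (both determinants are non-zero there since `c₇ ≤ 1/2016`). -/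
theorem detRatio_of_ghostTaylor (h7d : GhostTaylor) :
    ∃ C₇ c₇ : ℝ, 0 < c₇ ∧ ∀ H : ℕ, 1 ≤ H → ∀ t : ℝ, 0 ≤ t → t * (H : ℝ) ^ 2 ≤ c₇ →
      ∀ a a' : LandauFree H → E3, a ∈ smallField H t → a' ∈ smallField H t →
        |(fpOperator H (edgeChart H a)).det| ≤ Real.exp (C₇ * t * (H : ℝ) ^ 5) * |(fpOperator H (edgeChart H a')).det| := by
  obtain ⟨C₇, c₇, hc₇, -, h⟩ := abs_ghostLogRatio_sub_le_of h7d
  refine ⟨C₇, min c₇ (1 / 2016), lt_min hc₇ (by norm_num), fun H hH t ht0 htH a a' ha ha' => ?_⟩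
  have hda := det_fpOperator_edgeChart_ne_zero hH ht0 (htH.trans (min_le_right _ _)) ha
  have hda' := det_fpOperator_edgeChart_ne_zero hH ht0 (htH.trans (min_le_right _ _)) ha'
  have hb := h H hH t ht0 (htH.trans (min_le_left _ _)) a a' ha ha'
  have hpos' : 0 < |(fpOperator H (edgeChart H a')).det| := abs_pos.2 hda'
  -- `log|det F(U a)| − log|det F(U a′)| = ghostLogRatio a − ghostLogRatio a′ ≤ C₇ t H⁵`
  have hlog : Real.log |(fpOperator H (edgeChart H a)).det| ≤ C₇ * t * (H : ℝ) ^ 5 + Real.log |(fpOperator H (edgeChart H a')).det| := by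
    have e : Real.log |(fpOperator H (edgeChart H a)).det| - Real.log |(fpOperator H (edgeChart H a')).det| =
        ghostLogRatio H a - ghostLogRatio H a' := by simp only [ghostLogRatio]; ring
    linarith [(le_abs_self _).trans hb]
  calc |(fpOperator H (edgeChart H a)).det| = Real.exp (Real.log |(fpOperator H (edgeChart H a)).det|) := (Real.exp_log (abs_pos.2 hda)).symm
    _ ≤ Real.exp (C₇ * t * (H : ℝ) ^ 5 + Real.log |(fpOperator H (edgeChart H a')).det|) := Real.exp_le_exp.2 hlog
    _ = Real.exp (C₇ * t * (H : ℝ) ^ 5) * |(fpOperator H (edgeChart H a')).det| := by rw [Real.exp_add, Real.exp_log hpos']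

end TiltSup

/-- **T-S5.6 `SmallFieldInsideFP` GIVEN T-S5.7d only**: `GhostTaylor → SmallFieldInsideFP` — w4 g27's ✓`SmallFieldFP.smallFieldInsideFP_of` fed with w2 g31's
✓`actionSandwich` (6a) and the determinant ratio `TiltSup.detRatio_of_ghostTaylor` (6b from 7d). -/
theorem smallFieldInsideFP_of_ghostTaylor (h7d : GhostTaylor) : SmallFieldInsideFP :=
  SmallFieldFP.smallFieldInsideFP_of actionSandwich (TiltSup.detRatio_of_ghostTaylor h7d)

end Summit.QuantumFields.YangMills.Theorems.AllWindowsColdBoxBoxHighLine
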